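import Summits.SmoothPoincare4.SmoothPoincare4.Theorems.CongruenceShadowsAgkCor6SufficiencyStubUnitSectorProfile

/-!
# Helpers for stub `stub_seamForm` of line `lp-by-sphere-system-surgery` (crux `AgkCor6Sufficiency`,
item stmt-SmoothPoincare4-10894, routes CongruenceShadows / GroupTrisection; lead reshape r5, A3):
one-variable calculus

The seam normalisation modifies the normalised presentation `Gn` of a sector along a seam into
`Gn + χ · (1 - σ - Gn)` with `χ = θ · ψ(σ)`, `σ = G_ref - 1` the transverse seam coordinate and
`ψ` a **log-slow plateau**: `ψ = 1` near `0`, `ψ = 0` off `(-√δ, √δ)`, `|t ψ'(t)| ≤ η`.  This file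
proves the one-variable facts, bundled in the registered helper stub
`stub_seamFormCalcToolkit : SeamFormCalcToolkit`:

1. `exists_sqProfile`: the plateau `ψ(t) = ℓ(t² / δ)` for the log-slow step `ℓ` of
   `exists_logSlow_profile`;
2. `tubeProfile_deriv_pos`: in the tube, along the transverse line `s ↦ q + s` the modified
   function `1 + 2p(q+s) - 2(q+s)² + c ψ(-2p(q+s)) · 2(q+s)²` (`0 ≤ c ≤ 1`, `p > r₀ > 0`,
   `|q| < r₀ / 2`, `δ ≤ r₀⁴ / 16`, `|tψ'| ≤ 1`) has positive derivative at `s = 0`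
   (`= 2p - 4q(1 - cψ) + 2cq · [σψ'(σ)]`, and `|q| < r₀² / (8p)` wherever `ψ'(σ) ≠ 0`);
3. `exists_deriv_eq_slope_uIcc`: the mean value theorem on an unordered interval;
4. `dist_add_smul_e0_le`, `exists_lineMVT`: normal lines `z + t e₀` in the model space `ℝ⁴` and
   the mean value theorem along them inside a ball centred on the hyperplane `{z₀ = 0}`.

## References

* A. Abrams, D. Gay, R. Kirby, *Group trisections and smooth 4-manifolds*, Geom. Topol. 22
  (2018), proof of Thm. 5. [AbramsGayKirby2018]
* J. Milnor, *Morse theory* (1963), §2. [Milnor1963]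
-/

noncomputable section

-- the prescribed namespace `Summit.<P>.<Sub>.…` duplicates `SmoothPoincare4` (P = Sub)
set_option linter.dupNamespace false

open Set Function Filter Metric
open scoped Manifold ContDiff Topology

namespace Summit.SmoothPoincare4.SmoothPoincare4.Cruxes.AgkCor6Sufficiency.LpBySphereSystemSurgery

open Literature.Topology.FourManifolds

/-! ## 1. The log-slow plateau -/

/-- **A log-slow plateau.**  For `η > 0` and `δ > 0` there are a smooth `ψ : ℝ → ℝ` with values in
`[0, 1]` and `e > 0` with `e² < δ` such that `ψ = 1` on `(-e, e)`, `ψ(t) = 0` and `ψ'(t) = 0`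
whenever `δ ≤ t²`, and `|t · ψ'(t)| ≤ η` for all `t` (`ψ(t) = ℓ(t² / δ)` for the log-slow step
`ℓ` of `exists_logSlow_profile` with `|sℓ'(s)| ≤ η / 2`). [folklore] -/
theorem exists_sqProfile {η δ : ℝ} (hη : 0 < η) (hδ : 0 < δ) :
    ∃ (ψ : ℝ → ℝ) (e : ℝ), 0 < e ∧ e ^ 2 < δ ∧ ContDiff ℝ ∞ ψ ∧ (∀ t, 0 ≤ ψ t ∧ ψ t ≤ 1) ∧
      (∀ t, |t| < e → ψ t = 1) ∧ (∀ t, δ ≤ t ^ 2 → ψ t = 0) ∧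
      (∀ t, δ ≤ t ^ 2 → deriv ψ t = 0) ∧ ∀ t, |t * deriv ψ t| ≤ η := by
  obtain ⟨ℓ, a, ha, ha1, hℓs, hℓ01, hℓone, hℓzero, hℓε⟩ := exists_logSlow_profile (half_pos hη)
  set ψ : ℝ → ℝ := fun t => ℓ (t ^ 2 / δ) with hψ
  have hin : ∀ t, HasDerivAt (fun t : ℝ => t ^ 2 / δ) (2 * t / δ) t := fun t => by
    simpa using ((hasDerivAt_pow 2 t).div_const δ)
  have hψd : ∀ t, HasDerivAt ψ (deriv ℓ (t ^ 2 / δ) * (2 * t / δ)) t := fun t =>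
    ((hℓs.differentiable (by simp)) _).hasDerivAt.comp t (hin t)
  set e : ℝ := Real.sqrt (a * δ) with he
  have haδ : 0 < a * δ := mul_pos ha hδ
  have he2 : e ^ 2 = a * δ := by rw [he, Real.sq_sqrt haδ.le]
  have hepos : 0 < e := Real.sqrt_pos.2 haδ
  refine ⟨ψ, e, hepos, ?_, hℓs.comp (contDiff_id.pow 2 |>.div_const δ), fun t => hℓ01 _, ?_, ?_,
    ?_, ?_⟩
  · rw [he2]; nlinarith
  · intro t ht
    apply hℓone
    rw [div_le_iff₀ hδ]
    have h1 : t ^ 2 < e ^ 2 := by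
      have := abs_nonneg t
      calc t ^ 2 = |t| ^ 2 := (sq_abs t).symm
        _ < e ^ 2 := by gcongr
    rw [he2] at h1
    exact h1.le
  · intro t ht
    exact hℓzero _ (by rwa [le_div_iff₀ hδ, one_mul])
  · intro t ht
    rw [(hψd t).deriv]
    have hmin : IsLocalMin ℓ (t ^ 2 / δ) := by
      refine Filter.Eventually.of_forall fun s => ?_
      rw [hℓzero _ (by rwa [le_div_iff₀ hδ, one_mul])]
      exact (hℓ01 s).1
    rw [hmin.deriv_eq_zero, zero_mul]
  · intro t
    rw [(hψd t).deriv]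
    have h1 : t * (deriv ℓ (t ^ 2 / δ) * (2 * t / δ)) = 2 * (t ^ 2 / δ * deriv ℓ (t ^ 2 / δ)) := by
      ring
    rw [h1, abs_mul, abs_of_pos (two_pos : (0:ℝ) < 2)]
    have := hℓε (t ^ 2 / δ)
    linarith

/-! ## 2. The transverse derivative in the tube -/

/-- **The modified normalised presentation is transversally regular in the tube.**  For `ψ`
differentiable with values in `[0, 1]`, `|t ψ'(t)| ≤ 1` and `ψ'(t) = 0` whenever `δ ≤ t²`
(`δ ≤ r₀⁴ / 16`), and `0 ≤ c ≤ 1`, `r₀ < p`, `|q| < r₀ / 2`, the function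
`s ↦ Gn + cψ(σ)(1 - σ - Gn)` along the transverse line, `σ = -2p(q + s)`,
`Gn = 1 + 2p(q+s) - 2(q+s)²`, has positive derivative at `0`: it is
`2p - 4q(1 - cψ(σ)) + 2cq · σψ'(σ)` with `4|q| < 2r₀ < 2p` and, where `ψ'(σ) ≠ 0`, `σ² < δ` whence
`|q| < r₀ / 8`. [cite: AbramsGayKirby2018, proof of Thm. 5] -/
theorem tubeProfile_deriv_pos {ψ : ℝ → ℝ} (hψd : Differentiable ℝ ψ)
    (hψ01 : ∀ t, 0 ≤ ψ t ∧ ψ t ≤ 1) (hψ1 : ∀ t, |t * deriv ψ t| ≤ 1) {δ : ℝ}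
    (hψδ : ∀ t, δ ≤ t ^ 2 → deriv ψ t = 0) {r₀ p q c : ℝ} (hr₀ : 0 < r₀)
    (hδ : δ ≤ r₀ ^ 4 / 16) (hp : r₀ < p) (hq : |q| < r₀ / 2) (hc : 0 ≤ c ∧ c ≤ 1) :
    ∃ Φ' : ℝ, 0 < Φ' ∧ HasDerivAt (fun s : ℝ =>
      (1 + 2 * p * (q + s) - 2 * (q + s) ^ 2) + c * ψ (-2 * p * (q + s)) *
        (1 - (-2 * p * (q + s)) - (1 + 2 * p * (q + s) - 2 * (q + s) ^ 2))) Φ' 0 := by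
  have hp0 : 0 < p := hr₀.trans hp
  -- the pieces
  have hlin : HasDerivAt (fun s : ℝ => q + s) 1 0 := (hasDerivAt_id 0).const_add q
  have hσ : HasDerivAt (fun s : ℝ => -2 * p * (q + s)) (-2 * p) 0 := by
    simpa using hlin.const_mul (-2 * p)
  have hsq : HasDerivAt (fun s : ℝ => (q + s) ^ 2) (2 * q) 0 := by simpa using hlin.fun_pow 2
  have hGn : HasDerivAt (fun s : ℝ => 1 + 2 * p * (q + s) - 2 * (q + s) ^ 2)
      (2 * p - 4 * q) 0 :=
    (((hlin.const_mul (2 * p)).const_add 1).fun_sub (hsq.const_mul 2)).congr_deriv (by ring)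
  set σ₀ : ℝ := -2 * p * q with hσ₀
  have hψσ : HasDerivAt (fun s : ℝ => ψ (-2 * p * (q + s))) (deriv ψ σ₀ * (-2 * p)) 0 := by
    have h := (hψd σ₀).hasDerivAt
    have h' : HasDerivAt ψ (deriv ψ σ₀) (-2 * p * (q + 0)) := by simpa [hσ₀] using h
    exact h'.comp 0 hσ
  have hD : HasDerivAt (fun s : ℝ =>
      1 - (-2 * p * (q + s)) - (1 + 2 * p * (q + s) - 2 * (q + s) ^ 2)) (4 * q) 0 :=
    ((hσ.const_sub 1).fun_sub hGn).congr_deriv (by ring)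
  have hprod := (hψσ.const_mul c).fun_mul hD
  have hall := hGn.fun_add hprod
  refine ⟨_, ?_, hall⟩
  -- ### the sign
  simp only [add_zero]
  set ψ₀ := ψ σ₀ with hψ₀
  set ψ₀' := deriv ψ σ₀ with hψ₀'
  have hD0 : 1 - -2 * p * q - (1 + 2 * p * q - 2 * q ^ 2) = 2 * q ^ 2 := by ring
  rw [hD0]
  have hkey : c * (ψ₀' * (-2 * p)) * (2 * q ^ 2) = 2 * c * q * (σ₀ * ψ₀') := by
    rw [hσ₀]; ring
  rw [hkey]
  obtain ⟨hc0, hc1⟩ := hc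
  obtain ⟨hψ0, hψ1'⟩ := hψ01 σ₀
  have hq' : |q| < r₀ / 2 := hq
  have hcψ : 0 ≤ 1 - c * ψ₀ ∧ 1 - c * ψ₀ ≤ 1 := by
    constructor <;> nlinarith [mul_nonneg hc0 hψ0, mul_le_mul hc1 hψ1' hψ0 zero_le_one]
  -- the term `4 q (1 - c ψ₀)` is bounded by `4 |q| < 2 r₀`
  have hA : |4 * q * (1 - c * ψ₀)| ≤ 4 * |q| := by
    rw [abs_mul, abs_mul, abs_of_pos (by norm_num : (0:ℝ) < 4), abs_of_nonneg hcψ.1]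
    nlinarith [abs_nonneg q, hcψ.2]
  by_cases hcase : δ ≤ σ₀ ^ 2
  · -- `ψ'(σ₀) = 0`
    have h0 : ψ₀' = 0 := hψδ σ₀ hcase
    rw [h0, mul_zero, mul_zero, zero_add]
    have hA' := le_abs_self (4 * q * (1 - c * ψ₀))
    nlinarith [hA, hA', hq', hp]
  · -- `σ₀² < δ ≤ r₀⁴/16`, so `2 p |q| < r₀² / 4` and `|q| < r₀ / 8`
    have hσsmall : σ₀ ^ 2 < r₀ ^ 4 / 16 := lt_of_lt_of_le (not_le.1 hcase) hδ
    have h2pq : 2 * p * |q| < r₀ ^ 2 / 4 := by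
      have h1 : (2 * p * |q|) ^ 2 = σ₀ ^ 2 := by rw [hσ₀, mul_pow, sq_abs]; ring
      have h3 : (2 * p * |q|) ^ 2 < (r₀ ^ 2 / 4) ^ 2 := by rw [h1]; nlinarith
      exact (pow_lt_pow_iff_left₀ (by positivity) (by positivity) two_ne_zero).1 h3
    have hq8 : |q| < r₀ / 8 := by
      by_contra h
      have h' : r₀ / 8 ≤ |q| := not_lt.1 h
      nlinarith
    have hB : |2 * c * q * (σ₀ * ψ₀')| ≤ 2 * |q| := by
      have h1 := hψ1 σ₀
      rw [abs_mul, abs_mul, abs_mul, abs_of_pos (two_pos : (0:ℝ) < 2), abs_of_nonneg hc0]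
      calc 2 * c * |q| * |σ₀ * ψ₀'| ≤ 2 * 1 * |q| * 1 := by gcongr
        _ = 2 * |q| := by ring
    have hA' := le_abs_self (4 * q * (1 - c * ψ₀))
    have hB' := neg_abs_le (2 * c * q * (σ₀ * ψ₀'))
    nlinarith [hA, hA', hB, hB', hq8, hp, hr₀]

/-! ## 3. The mean value theorem on an unordered interval -/

/-- **Mean value theorem on an unordered interval**: if `φ` has derivative `φ'` at every point of
`[min a b, max a b]` then `φ b - φ a = φ'(c) (b - a)` for some `c` between `a` and `b`.
[folklore] -/
theorem exists_deriv_eq_slope_uIcc {φ φ' : ℝ → ℝ} {a b : ℝ}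
    (hφ : ∀ t ∈ uIcc a b, HasDerivAt φ (φ' t) t) :
    ∃ c ∈ uIcc a b, φ b - φ a = φ' c * (b - a) := by
  rcases lt_trichotomy a b with hab | rfl | hab
  · have hcont : ContinuousOn φ (Icc a b) := fun t ht =>
      (hφ t (by rwa [uIcc_of_le hab.le])).continuousAt.continuousWithinAt
    obtain ⟨c, hc, hceq⟩ := exists_hasDerivAt_eq_slope φ φ' hab hcont
      (fun t ht => hφ t (by rw [uIcc_of_le hab.le]; exact Ioo_subset_Icc_self ht))
    refine ⟨c, by rw [uIcc_of_le hab.le]; exact Ioo_subset_Icc_self hc, ?_⟩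
    rw [hceq, div_mul_cancel₀ _ (sub_ne_zero.2 hab.ne')]
  · exact ⟨a, left_mem_uIcc, by simp⟩
  · have hcont : ContinuousOn φ (Icc b a) := fun t ht =>
      (hφ t (by rwa [uIcc_of_ge hab.le])).continuousAt.continuousWithinAt
    obtain ⟨c, hc, hceq⟩ := exists_hasDerivAt_eq_slope φ φ' hab hcont
      (fun t ht => hφ t (by rw [uIcc_of_ge hab.le]; exact Ioo_subset_Icc_self ht))
    refine ⟨c, by rw [uIcc_of_ge hab.le]; exact Ioo_subset_Icc_self hc, ?_⟩
    have hne : b - a ≠ 0 := sub_ne_zero.2 hab.ne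
    have : φ a - φ b = φ' c * (a - b) := by
      rw [hceq, div_mul_cancel₀ _ (sub_ne_zero.2 hab.ne')]
    linarith

/-! ## 4. Normal lines in the model space `ℝ⁴` -/

/-- The normal unit vector `e₀ = (1, 0, 0, 0)` of the model space `ℝ⁴`. -/
abbrev e0 : EuclideanSpace ℝ (Fin 4) := EuclideanSpace.single 0 1

/-- Moving along the normal line towards the hyperplane `{z₀ = 0}` through `zc` does not increase
the distance to `zc`. -/
theorem dist_add_smul_e0_le {zc z : EuclideanSpace ℝ (Fin 4)} (hzc : zc 0 = 0) {s : ℝ}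
    (hs : |z 0 + s| ≤ |z 0|) : dist (z + s • e0) zc ≤ dist z zc := by
  rw [EuclideanSpace.dist_eq, EuclideanSpace.dist_eq]
  apply Real.sqrt_le_sqrt
  rw [Fin.sum_univ_four, Fin.sum_univ_four]
  have h2 := sq_le_sq.2 hs
  simp [e0, hzc]
  nlinarith [h2, sq_abs (z 0 + s), sq_abs (z 0)]

/-- **Mean value theorem along the normal line** from the hyperplane `{z₀ = 0}` to `z`, inside a
ball centred on the hyperplane: `F z - F (z - z₀ e₀) = dF(ξ) e₀ · z₀` for some `ξ` in the ball.
[folklore] -/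
theorem exists_lineMVT {F : EuclideanSpace ℝ (Fin 4) → ℝ}
    {F' : EuclideanSpace ℝ (Fin 4) → EuclideanSpace ℝ (Fin 4) →L[ℝ] ℝ}
    {zc : EuclideanSpace ℝ (Fin 4)} {r : ℝ} (hzc0 : zc 0 = 0)
    (hF : ∀ w ∈ ball zc r, HasFDerivAt F (F' w) w) {z : EuclideanSpace ℝ (Fin 4)}
    (hz : z ∈ ball zc r) :
    ∃ ξ ∈ ball zc r, F z - F (z + (-(z 0)) • e0) = F' ξ e0 * z 0 := by
  have hmem : ∀ t ∈ uIcc (-(z 0)) 0, z + t • e0 ∈ ball zc r := by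
    intro t ht
    rw [Metric.mem_ball] at hz ⊢
    refine lt_of_le_of_lt (dist_add_smul_e0_le hzc0 ?_) hz
    rcases le_total 0 (z 0) with h | h
    · rw [uIcc_of_le (by linarith : -(z 0) ≤ 0)] at ht
      rw [abs_of_nonneg h, abs_le]; constructor <;> linarith [ht.1, ht.2]
    · rw [uIcc_of_ge (by linarith : (0:ℝ) ≤ -(z 0))] at ht
      rw [abs_of_nonpos h, abs_le]; constructor <;> linarith [ht.1, ht.2]
  have hderiv : ∀ t ∈ uIcc (-(z 0)) 0,
      HasDerivAt (fun t : ℝ => F (z + t • e0)) (F' (z + t • e0) e0) t := by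
    intro t ht
    have hL : HasDerivAt (fun t : ℝ => z + t • e0) e0 t := by
      simpa using ((hasDerivAt_id t).smul_const e0).const_add z
    exact (hF _ (hmem t ht)).comp_hasDerivAt t hL
  obtain ⟨c, hc, hceq⟩ := exists_deriv_eq_slope_uIcc hderiv
  refine ⟨z + c • e0, hmem c hc, ?_⟩
  simpa using hceq

/-! ## The toolkit (a registered helper stub) -/

/-- **The one-variable toolkit of the seam normalisation** (registered helper stub of the line,
proved in this file): the log-slow plateau, the transverse derivative in the tube, and the mean
value theorem along normal lines of `ℝ⁴`. -/
def SeamFormCalcToolkit : Prop :=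
  (∀ η δ : ℝ, 0 < η → 0 < δ →
    ∃ (ψ : ℝ → ℝ) (e : ℝ), 0 < e ∧ e ^ 2 < δ ∧ ContDiff ℝ ∞ ψ ∧ (∀ t, 0 ≤ ψ t ∧ ψ t ≤ 1) ∧
      (∀ t, |t| < e → ψ t = 1) ∧ (∀ t, δ ≤ t ^ 2 → ψ t = 0) ∧
      (∀ t, δ ≤ t ^ 2 → deriv ψ t = 0) ∧ ∀ t, |t * deriv ψ t| ≤ η) ∧
  (∀ (ψ : ℝ → ℝ), Differentiable ℝ ψ → (∀ t, 0 ≤ ψ t ∧ ψ t ≤ 1) →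
    (∀ t, |t * deriv ψ t| ≤ 1) → ∀ (δ : ℝ), (∀ t, δ ≤ t ^ 2 → deriv ψ t = 0) →
    ∀ (r₀ p q c : ℝ), 0 < r₀ → δ ≤ r₀ ^ 4 / 16 → r₀ < p → |q| < r₀ / 2 → (0 ≤ c ∧ c ≤ 1) →
    ∃ Φ' : ℝ, 0 < Φ' ∧ HasDerivAt (fun s : ℝ =>
      (1 + 2 * p * (q + s) - 2 * (q + s) ^ 2) + c * ψ (-2 * p * (q + s)) *
        (1 - (-2 * p * (q + s)) - (1 + 2 * p * (q + s) - 2 * (q + s) ^ 2))) Φ' 0) ∧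
  (∀ (F : EuclideanSpace ℝ (Fin 4) → ℝ)
    (F' : EuclideanSpace ℝ (Fin 4) → EuclideanSpace ℝ (Fin 4) →L[ℝ] ℝ)
    (zc : EuclideanSpace ℝ (Fin 4)) (r : ℝ), zc 0 = 0 →
    (∀ w ∈ ball zc r, HasFDerivAt F (F' w) w) → ∀ z ∈ ball zc r,
    ∃ ξ ∈ ball zc r, F z - F (z + (-(z 0)) • e0) = F' ξ e0 * z 0)

/-- **Registered helper stub `stub_seamFormCalcToolkit`** of line `lp-by-sphere-system-surgery`
(one-variable toolkit for the seam normalisation `stub_seamForm`). [folklore] -/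
theorem stub_seamFormCalcToolkit : SeamFormCalcToolkit :=
  ⟨fun _ _ hη hδ => exists_sqProfile hη hδ,
    fun _ hψd hψ01 hψ1 _ hψδ _ _ _ _ hr₀ hδ hp hq hc =>
      tubeProfile_deriv_pos hψd hψ01 hψ1 hψδ hr₀ hδ hp hq hc,
    fun _ _ _ _ hzc0 hF _ hz => exists_lineMVT hzc0 hF hz⟩

end Summit.SmoothPoincare4.SmoothPoincare4.Cruxes.AgkCor6Sufficiency.LpBySphereSystemSurgery

end
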